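import Mathlib.LinearAlgebra.Dual.Lemmas
import Literature.NumberTheory.DiophantineGeometry.WordModelSelfDuality
import Literature.NumberTheory.DiophantineGeometry.GLPolynomialRepSemisimpleProofs
import Literature.NumberTheory.DiophantineGeometry.SymmetricGroupCharacterProjectors
import HarnessLib

/-!
# The vector-valued word model `V^{⊗D} ⊗ E` of a tensor power with a multiplicity space

Topic file in the Schur–Weyl series (trunk ArithGeomL / CplxAlg). For the proof of
Christandl–Vrana–Zuiddam, Lemma 3.11 / 3.13 one needs Schur–Weyl duality on one *family* of legs
of an `n`-fold tensor power of a `3`-tensor, `(V_1 ⊗ V_2 ⊗ V_3)^{⊗n} ≅ V_1^{⊗n} ⊗ (V_2 ⊗ V_3)^{⊗n}`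
(CVZ §3.1: "`GL(V_S) × S_n` acts naturally on `(V_1 ⊗ ⋯ ⊗ V_k)^{⊗n}`, which decomposes as
`⊕_λ S_λ(V_S) ⊗ [λ] ⊗ (V_{S̄})^{⊗n}` with `GL(V_S)` acting trivially on `(V_{S̄})^{⊗n}`"). In
coordinates this is the space of functions `Word N D → E` on words with values in a
finite-dimensional multiplicity space `E`, with `GL_N` acting through the Kronecker power of the
matrix on the word argument (`vecWordRep`, the tree's `wordRep` tensored with the identity of
`E`) and `S_D` permuting the positions (`vecWordPermRep`). This file defines these two
representations and transfers to them, by testing with linear functionals `E → k`, the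
word-model results of `TensorWordModel`, `WordHighestWeightSpecht`, `WordModelSelfDuality` and
`SymmetricGroupCharacterProjectors`:

* `mem_highestWeightSpace_vecWordRep_iff`, `apply_eq_zero_of_mem_weightSpace_vecWordRep`
  (weight vectors are supported on words of the right content),
  `exists_partition_of_mem_highestWeightSpace_vecWordRep` (highest weights are partitions with at
  most `N` parts);
* `charSum_apply_of_mem_highestWeightSpace` / `…_vecWordRep` — on highest-weight vectors of weight
  `μ` the character sum `Z_λ = ∑_π χ^λ(π) π` acts as `δ_{λμ} D!/f^μ` (Schur–Weyl duality,
  `S_D`-module form: `HW_μ ≅ S^μ`, the tree's `spechtEquivHw`);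
* `isPolynomialRep_vecWordRep`, `exists_mem_highestWeightSpace_of_stable_vecWordRep` (nonzero
  stable subspaces contain highest-weight vectors) and
  `le_span_translates_highestWeight_vecWordRep` — **a `GL_N`-stable subspace is spanned by the
  translates of its highest-weight vectors** (complete reducibility,
  `isSemisimpleRepresentation_of_isRationalRep_holds`, plus the previous item).

References: M. Christandl, P. Vrana, J. Zuiddam, J. Amer. Math. Soc. 36 (2023), §3.1
[cite: ChristandlVranaZuiddam2023, §3.1]; W. Fulton, J. Harris, *Representation Theory*, GTM 129,
Thm. 6.3, §15.5 [FultonHarrisGTM129]; R. Goodman, N. Wallach, GTM 255, §9.1.1, Cor. 3.2.3,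
Thm. 3.3.11 [GoodmanWallachGTM255].
-/

noncomputable section

open scoped BigOperators

namespace Literature.NumberTheory.DiophantineGeometry

section Defs

variable (k : Type*) [Field k] (N D : ℕ) (E : Type*) [AddCommGroup E] [Module k E]

/-- **The vector-valued word model.** The representation of `GL_N(k)` on functions
`Word N D → E` (the coordinate model of `(k^N)^{⊗D} ⊗ E` for a multiplicity space `E` on which
`GL_N` acts trivially): `(g · Y)(w') = ∑_w (∏_p g_{w' p, w p}) • Y(w)`, the Kronecker power
`tensorPowerMatrix` of `g` acting on the word argument (CVZ §3.1, `GL(V_S)` acting on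
`V_S^{⊗n} ⊗ (V_{S̄})^{⊗n}`; Goodman–Wallach §9.1.1). [cite: ChristandlVranaZuiddam2023, §3.1] -/
def vecWordRep : Representation k (GL (Fin N) k) (Word N D → E) where
  toFun g :=
    { toFun := fun Y w' => ∑ w, tensorPowerMatrix k N D (g : Matrix (Fin N) (Fin N) k) w' w • Y w
      map_add' := fun Y Y' => by
        funext w'
        simp only [Pi.add_apply, smul_add, Finset.sum_add_distrib]
      map_smul' := fun c Y => by
        funext w'
        simp only [Pi.smul_apply, RingHom.id_apply, Finset.smul_sum]
        exact Finset.sum_congr rfl fun w _ => smul_comm _ _ _ }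
  map_one' := by
    apply LinearMap.ext
    intro Y
    funext w'
    simp only [LinearMap.coe_mk, AddHom.coe_mk, Units.val_one, tensorPowerMatrix_one,
      Module.End.one_apply]
    rw [Finset.sum_eq_single w']
    · simp
    · intro w _ hw
      rw [Matrix.one_apply_ne (Ne.symm hw), zero_smul]
    · intro h
      exact absurd (Finset.mem_univ w') h
  map_mul' g h := by
    apply LinearMap.ext
    intro Y
    funext w'
    simp only [LinearMap.coe_mk, AddHom.coe_mk, Units.val_mul, tensorPowerMatrix_mul,
      Module.End.mul_apply, Matrix.mul_apply, Finset.sum_smul, Finset.smul_sum, mul_smul]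
    rw [Finset.sum_comm]

/-- **The action of `S_D` permuting the positions** on the vector-valued word model:
`(σ · Y)(w) = Y(w ∘ σ)` (CVZ §3.1, `S_n` permuting the tensor legs; the tree's `wordPerm` with
values in `E`). It commutes with `vecWordRep` (`vecWordPermRep_vecWordRep`).
[cite: ChristandlVranaZuiddam2023, §3.1] -/
def vecWordPermRep : Representation k (Equiv.Perm (Fin D)) (Word N D → E) where
  toFun σ :=
    { toFun := fun Y w => Y (w ∘ σ)
      map_add' := fun _ _ => rfl
      map_smul' := fun _ _ => rfl }
  map_one' := rfl
  map_mul' _ _ := rfl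

end Defs

section Basic

variable {k : Type*} [Field k] {N D : ℕ} {E : Type*} [AddCommGroup E] [Module k E]

/-- Unfolding of `vecWordRep`. [folklore] -/
theorem vecWordRep_apply (g : GL (Fin N) k) (Y : Word N D → E) (w' : Word N D) :
    vecWordRep k N D E g Y w' =
      ∑ w, (∏ p, (g : Matrix (Fin N) (Fin N) k) (w' p) (w p)) • Y w :=
  rfl

/-- Unfolding of `vecWordPermRep`. [folklore] -/
@[simp] theorem vecWordPermRep_apply (σ : Equiv.Perm (Fin D)) (Y : Word N D → E) (w : Word N D) :
    vecWordPermRep k N D E σ Y w = Y (w ∘ σ) :=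
  rfl

/-- Testing with a linear functional `φ : E → k` turns `vecWordRep` into the word model `wordRep`.
[folklore] -/
theorem dual_comp_vecWordRep (φ : E →ₗ[k] k) (g : GL (Fin N) k) (Y : Word N D → E) :
    (fun w => φ (vecWordRep k N D E g Y w)) = wordRep k N D g (fun w => φ (Y w)) := by
  funext w'
  rw [vecWordRep_apply, wordRep_apply, map_sum]
  refine Finset.sum_congr rfl fun w _ => ?_
  rw [map_smul, smul_eq_mul]

/-- A linear map `L : E → E'` applied pointwise commutes with the `GL_N`-actions. [folklore] -/
theorem linearMap_comp_vecWordRep {E' : Type*} [AddCommGroup E'] [Module k E'] (L : E →ₗ[k] E')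
    (g : GL (Fin N) k) (Y : Word N D → E) :
    (fun w => L (vecWordRep k N D E g Y w)) = vecWordRep k N D E' g (fun w => L (Y w)) := by
  funext w'
  rw [vecWordRep_apply, vecWordRep_apply, map_sum]
  refine Finset.sum_congr rfl fun w _ => ?_
  rw [map_smul]

/-- A linear map applied pointwise commutes with the position permutations. [folklore] -/
theorem linearMap_comp_vecWordPermRep {E' : Type*} [AddCommGroup E'] [Module k E']
    (L : E →ₗ[k] E') (σ : Equiv.Perm (Fin D)) (Y : Word N D → E) :
    (fun w => L (vecWordPermRep k N D E σ Y w)) = vecWordPermRep k N D E' σ (fun w => L (Y w)) :=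
  rfl

/-- **The actions of `S_D` and `GL_N` commute** on the vector-valued word model.
[cite: ChristandlVranaZuiddam2023, Lemma 3.2] -/
theorem vecWordPermRep_vecWordRep (σ : Equiv.Perm (Fin D)) (g : GL (Fin N) k) (Y : Word N D → E) :
    vecWordPermRep k N D E σ (vecWordRep k N D E g Y) =
      vecWordRep k N D E g (vecWordPermRep k N D E σ Y) := by
  funext w'
  simp only [vecWordPermRep_apply, vecWordRep_apply]
  -- reindex the right-hand sum along `w ↦ w ∘ σ`
  let e : Word N D ≃ Word N D :=
    { toFun := fun w => w ∘ ⇑σ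
      invFun := fun w => w ∘ ⇑σ⁻¹
      left_inv := fun w => by funext p; simp
      right_inv := fun w => by funext p; simp }
  symm
  refine Fintype.sum_equiv e _ _ fun w => ?_
  change _ = (∏ p, (g : Matrix (Fin N) (Fin N) k) (w' (σ p)) (w (σ p))) • Y (w ∘ ⇑σ)
  rw [Equiv.prod_comp σ (fun q => (g : Matrix (Fin N) (Fin N) k) (w' q) (w q))]

/-- The character sum tested with a functional. [folklore] -/
theorem dual_charSum_vecWordPermRep_apply (φ : E →ₗ[k] k) (lam : Nat.Partition D)
    (Y : Word N D → E) (w : Word N D) :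
    φ ((∑ π, spechtCharacter k lam π • vecWordPermRep k N D E π) Y w) =
      (∑ π, spechtCharacter k lam π • wordPermRep k N D π) (fun w => φ (Y w)) w := by
  rw [LinearMap.sum_apply, LinearMap.sum_apply, Finset.sum_apply, Finset.sum_apply, map_sum]
  refine Finset.sum_congr rfl fun π _ => ?_
  rw [LinearMap.smul_apply, LinearMap.smul_apply, Pi.smul_apply, Pi.smul_apply, map_smul]
  rfl

/-! ### Highest-weight and weight vectors, tested with functionals -/

/-- A vector of the `E`-valued word model is a highest-weight vector of weight `χ` iff all its
functional slices `w ↦ φ(Y w)` are highest-weight vectors of weight `χ` of the word model.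
[folklore] -/
theorem mem_highestWeightSpace_vecWordRep_iff (χ : Weight (Fin N)) (Y : Word N D → E) :
    Y ∈ highestWeightSpace (vecWordRep k N D E) χ ↔
      ∀ φ : Module.Dual k E, (fun w => φ (Y w)) ∈ highestWeightSpace (wordRep k N D) χ := by
  constructor
  · intro hY φ g hg
    rw [← dual_comp_vecWordRep, hY g hg]
    funext w
    simp
  · intro h g hg
    funext w
    rw [← sub_eq_zero, ← Module.forall_dual_apply_eq_zero_iff k]
    intro φ
    have h1 := congrFun (h φ g hg) w
    rw [← dual_comp_vecWordRep] at h1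
    simp only [Pi.smul_apply, smul_eq_mul] at h1
    rw [map_sub, Pi.smul_apply, map_smul, smul_eq_mul, h1, sub_self]

/-- Functional slices of weight vectors are weight vectors. [folklore] -/
theorem dual_comp_mem_weightSpace {χ : Weight (Fin N)} {Y : Word N D → E}
    (hY : Y ∈ weightSpace (vecWordRep k N D E) χ) (φ : Module.Dual k E) :
    (fun w => φ (Y w)) ∈ weightSpace (wordRep k N D) χ := by
  intro t ht
  rw [← dual_comp_vecWordRep, hY t ht]
  funext w
  simp

/-- **Weight vectors are supported on words of the right content** (characteristic zero): if `Y`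
is a weight vector of weight `χ` then `Y w = 0` unless `content(w) = χ`.
[cite: FultonHarrisGTM129, §15.5] -/
theorem apply_eq_zero_of_mem_weightSpace_vecWordRep [CharZero k] {χ : Weight (Fin N)}
    {Y : Word N D → E} (hY : Y ∈ weightSpace (vecWordRep k N D E) χ) {w : Word N D} {i : Fin N}
    (hw : (wordContent w i : ℤ) ≠ χ i) : Y w = 0 := by
  rw [← Module.forall_dual_apply_eq_zero_iff k]
  intro φ
  exact apply_eq_zero_of_mem_weightSpace k (dual_comp_mem_weightSpace hY φ) hw

/-- Highest-weight vectors are supported on words of content `χ`. [folklore] -/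
theorem apply_eq_zero_of_mem_highestWeightSpace_vecWordRep [CharZero k] {χ : Weight (Fin N)}
    {Y : Word N D → E} (hY : Y ∈ highestWeightSpace (vecWordRep k N D E) χ) {w : Word N D}
    {i : Fin N} (hw : (wordContent w i : ℤ) ≠ χ i) : Y w = 0 :=
  apply_eq_zero_of_mem_weightSpace_vecWordRep (highestWeightSpace_le_weightSpace _ χ hY) hw

/-- **Highest weights of the vector-valued word model are partitions with at most `N` parts**
(characteristic zero). [cite: FultonHarrisGTM129, Thm. 6.3] -/
theorem exists_partition_of_mem_highestWeightSpace_vecWordRep [CharZero k] {χ : Weight (Fin N)}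
    {Y : Word N D → E} (hY : Y ∈ highestWeightSpace (vecWordRep k N D E) χ) (hY0 : Y ≠ 0) :
    ∃ μ : Nat.Partition D, μ.parts.card ≤ N ∧ Weight.ofPartition N μ = χ := by
  obtain ⟨w, hw⟩ : ∃ w, Y w ≠ 0 := by
    by_contra h
    push Not at h
    exact hY0 (funext h)
  obtain ⟨φ, hφ⟩ : ∃ φ : Module.Dual k E, φ (Y w) ≠ 0 := by
    by_contra h
    push Not at h
    exact hw ((Module.forall_dual_apply_eq_zero_iff k (Y w)).1 h)
  refine exists_partition_of_highestWeightSpace_ne_bot (k := k) (N := N) (D := D) fun hbot => hφ ?_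
  have hmem := (mem_highestWeightSpace_vecWordRep_iff χ Y).1 hY φ
  rw [hbot, Submodule.mem_bot] at hmem
  exact congrFun hmem w

/-! ### The character sum on highest-weight vectors (Schur–Weyl, `S_D`-module form) -/

/-- **`Z_λ` on `HW_μ` of the word model is `δ_{λμ} D!/f^μ`** (algebraically closed field of
characteristic zero, `μ` with at most `N` parts): `HW_μ((k^N)^{⊗D}) ≅ S^μ` as `S_D`-modules
(`spechtEquivHw`), on which `Z_λ` is that scalar (`charSum_eq_smul_of_equiv`).
[cite: FultonHarrisGTM129, Thm. 6.3 (2)] -/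
theorem charSum_apply_of_mem_highestWeightSpace [IsAlgClosed k] [CharZero k]
    (μ : Nat.Partition D) (hμ : μ.parts.card ≤ N) {x : Word N D → k}
    (hx : x ∈ highestWeightSpace (wordRep k N D) (Weight.ofPartition N μ)) (lam : Nat.Partition D) :
    (∑ π, spechtCharacter k lam π • wordPermRep k N D π) x =
      (if lam = μ then (D.factorial : k) / (numStandardTableaux μ : k) else 0) • x := by
  have h := charSum_eq_smul_of_equiv (hwPermRep k (D := D) (Weight.ofPartition N μ))
    (spechtEquivHw k μ hμ).symm lam
  have h' := congrArg (fun f => ((f ⟨x, hx⟩ : highestWeightSpace (wordRep k N D)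
    (Weight.ofPartition N μ)) : Word N D → k)) h
  simp only [LinearMap.sum_apply, LinearMap.smul_apply, LinearMap.id_coe, id_eq,
    Submodule.coe_sum, Submodule.coe_smul_of_tower, coe_hwPermRep_apply] at h'
  rw [LinearMap.sum_apply]
  simp only [LinearMap.smul_apply, wordPermRep_apply]
  exact h'

/-- **`Z_λ` on highest-weight vectors of weight `μ` of the `E`-valued word model is
`δ_{λμ} D!/f^μ`.** [cite: FultonHarrisGTM129, Thm. 6.3 (2)] -/
theorem charSum_apply_of_mem_highestWeightSpace_vecWordRep [IsAlgClosed k] [CharZero k]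
    (μ : Nat.Partition D) (hμ : μ.parts.card ≤ N) {Y : Word N D → E}
    (hY : Y ∈ highestWeightSpace (vecWordRep k N D E) (Weight.ofPartition N μ))
    (lam : Nat.Partition D) :
    (∑ π, spechtCharacter k lam π • vecWordPermRep k N D E π) Y =
      (if lam = μ then (D.factorial : k) / (numStandardTableaux μ : k) else 0) • Y := by
  funext w
  rw [← sub_eq_zero, ← Module.forall_dual_apply_eq_zero_iff k]
  intro φ
  have hφ := (mem_highestWeightSpace_vecWordRep_iff _ Y).1 hY φ
  rw [map_sub, dual_charSum_vecWordPermRep_apply, charSum_apply_of_mem_highestWeightSpace μ hμ hφ,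
    Pi.smul_apply, Pi.smul_apply, map_smul, sub_self]

/-! ### Polynomiality; highest-weight vectors of stable subspaces -/

open MvPolynomial in
/-- **The vector-valued word model is a polynomial representation** (matrix coefficients are
polynomials in the entries of `g`). [cite: GoodmanWallachGTM255, §9.1.1] -/
theorem isPolynomialRep_vecWordRep : IsPolynomialRep (vecWordRep k N D E) := by
  classical
  intro Y ψ
  refine ⟨∑ w' : Word N D, ∑ w : Word N D,
    C (ψ (Pi.single w' (Y w))) * ∏ p, X ((w' p, w p) : Fin N × Fin N), fun g => ?_⟩
  have hexp : vecWordRep k N D E g Y =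
      ∑ w', (Pi.single w' (vecWordRep k N D E g Y w') : Word N D → E) :=
    (Finset.univ_sum_single _).symm
  rw [hexp, map_sum, map_sum]
  refine Finset.sum_congr rfl fun w' _ => ?_
  set ψw : E →ₗ[k] k := ψ.comp (LinearMap.single k (fun _ : Word N D => E) w') with hψw
  have hψw_apply : ∀ e : E, ψ (Pi.single w' e) = ψw e := fun e => rfl
  rw [hψw_apply, vecWordRep_apply, map_sum, map_sum]
  refine Finset.sum_congr rfl fun w _ => ?_
  rw [map_smul, smul_eq_mul]
  simp only [map_mul, eval_C, map_prod, eval_X, hψw_apply]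
  ring

/-- The subrepresentation of `vecWordRep` on a stable subspace is rational (its matrix
coefficients are matrix coefficients of `vecWordRep`, through a left inverse of the inclusion).
[folklore] -/
theorem isRationalRep_subrepresentation_vecWordRep (U : Submodule k (Word N D → E))
    (hU : ∀ g, U ≤ U.comap (vecWordRep k N D E g)) :
    IsRationalRep ((vecWordRep k N D E).subrepresentation U hU) := by
  set ρU := (vecWordRep k N D E).subrepresentation U hU with hρU
  obtain ⟨π, hπ⟩ := LinearMap.exists_leftInverse_of_injective U.subtype
    (LinearMap.ker_eq_bot.mpr U.injective_subtype)
  refine IsPolynomialRep.isRationalRep fun u φ => ?_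
  obtain ⟨P, hP⟩ := isPolynomialRep_vecWordRep (k := k) (N := N) (D := D) (E := E)
    (u : Word N D → E) (φ ∘ₗ π)
  refine ⟨P, fun g => ?_⟩
  rw [← hP g, LinearMap.comp_apply]
  congr 1
  have := LinearMap.congr_fun hπ (ρU g u)
  rw [LinearMap.comp_apply, LinearMap.id_apply] at this
  rw [← this]
  rfl

variable [FiniteDimensional k E]

/-- **Nonzero `GL_N`-stable subspaces of the vector-valued word model contain highest-weight
vectors** (infinite field): Lie–Kolchin-type existence (`exists_hasHighestWeight_of_isRationalRep`)
for the rational subrepresentation. [cite: GoodmanWallachGTM255, Cor. 3.2.3 (proof)] -/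
theorem exists_mem_highestWeightSpace_of_stable_vecWordRep [Infinite k]
    (U : Submodule k (Word N D → E)) (hU : ∀ g, U ≤ U.comap (vecWordRep k N D E g))
    (hU0 : U ≠ ⊥) :
    ∃ χ : Weight (Fin N), ∃ v ∈ U, v ≠ 0 ∧ v ∈ highestWeightSpace (vecWordRep k N D E) χ := by
  set ρU := (vecWordRep k N D E).subrepresentation U hU with hρU
  haveI : Nontrivial U := Submodule.nontrivial_iff_ne_bot.mpr hU0
  have hrat : IsRationalRep ρU := isRationalRep_subrepresentation_vecWordRep U hU
  obtain ⟨χ, hχ⟩ := exists_hasHighestWeight_of_isRationalRep ρU hrat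
  obtain ⟨v, hv0, hv⟩ := (hasHighestWeight_iff_exists _ _).mp hχ
  refine ⟨χ, v, v.2, fun h0 => hv0 (Subtype.ext h0), fun b hb => ?_⟩
  exact congrArg Subtype.val (hv b hb)

/-- **A `GL_N`-stable subspace of the vector-valued word model is spanned by the translates of its
highest-weight vectors** (characteristic zero): by complete reducibility
(`isSemisimpleRepresentation_of_isRationalRep_holds`) the span `K` of these translates has an
invariant complement inside `M`, which by the previous theorem would contain a further
highest-weight vector unless it is zero. [cite: GoodmanWallachGTM255, Thm. 3.3.11 with Cor. 3.2.3] -/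
theorem le_span_translates_highestWeight_vecWordRep [CharZero k]
    (M : Submodule k (Word N D → E)) (hM : ∀ g, M ≤ M.comap (vecWordRep k N D E g)) :
    M ≤ Submodule.span k {x | ∃ (g : GL (Fin N) k) (v : Word N D → E) (χ : Weight (Fin N)),
        v ∈ M ∧ v ∈ highestWeightSpace (vecWordRep k N D E) χ ∧ x = vecWordRep k N D E g v} := by
  haveI : Infinite k := Infinite.of_injective (Nat.cast : ℕ → k) Nat.cast_injective
  set ρ := vecWordRep k N D E with hρ
  set S : Set (Word N D → E) := {x | ∃ (g : GL (Fin N) k) (v : Word N D → E) (χ : Weight (Fin N)),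
    v ∈ M ∧ v ∈ highestWeightSpace ρ χ ∧ x = ρ g v} with hS
  set K := Submodule.span k S with hK
  -- `K` is stable
  have hKstab : ∀ g, K ≤ K.comap (ρ g) := by
    intro g
    rw [← Submodule.map_le_iff_le_comap, hK, Submodule.map_span]
    refine Submodule.span_mono ?_
    rintro _ ⟨x, ⟨g', v, χ, hv, hvχ, rfl⟩, rfl⟩
    exact ⟨g * g', v, χ, hv, hvχ, by rw [map_mul]; rfl⟩
  -- the subrepresentation on `M` is completely reducible
  let ρM := ρ.subrepresentation M hM
  have hratM : IsRationalRep ρM := isRationalRep_subrepresentation_vecWordRep M hM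
  haveI : ρM.IsSemisimpleRepresentation :=
    isSemisimpleRepresentation_of_isRationalRep_holds (σ := Fin N) (k := k) (V := M) hratM
  -- `K ∩ M` as a subrepresentation of `ρM`, and an invariant complement `K'`
  let Ksub : Subrepresentation ρM :=
    ⟨K.comap M.subtype, fun g x hx => by
      change ((ρM g x : M) : Word N D → E) ∈ K
      exact hKstab g hx⟩
  obtain ⟨K', hKK'⟩ := exists_isCompl Ksub
  by_contra hne
  -- `K' ≠ ⊥`, since otherwise `M ≤ K`
  have hK'ne : K'.toSubmodule ≠ ⊥ := by
    intro hbot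
    apply hne
    intro x hx
    have hK'bot : K' = ⊥ := Subrepresentation.toSubmodule_injective hbot
    have htop : Ksub = ⊤ := by
      have := hKK'.sup_eq_top
      rwa [hK'bot, sup_bot_eq] at this
    have hmem : (⟨x, hx⟩ : M) ∈ Ksub := by
      rw [htop]
      exact Submodule.mem_top
    exact hmem
  -- `K'`, pushed into the word model, is a nonzero stable subspace: it has a highest-weight vector
  set K'' : Submodule k (Word N D → E) := K'.toSubmodule.map M.subtype with hK''
  have hK''ne : K'' ≠ ⊥ := by
    obtain ⟨x, hx, hx0⟩ := (Submodule.ne_bot_iff _).1 hK'ne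
    rw [Submodule.ne_bot_iff]
    exact ⟨(x : Word N D → E), ⟨x, hx, rfl⟩, fun h0 => hx0 (Subtype.ext h0)⟩
  have hK''stab : ∀ g, K'' ≤ K''.comap (ρ g) := by
    rintro g _ ⟨x, hx, rfl⟩
    exact ⟨ρM g x, K'.apply_mem_toSubmodule g hx, rfl⟩
  obtain ⟨χ, v, hvK'', hv0, hvχ⟩ :=
    exists_mem_highestWeightSpace_of_stable_vecWordRep K'' hK''stab hK''ne
  obtain ⟨x, hxK', hxv⟩ := hvK''
  -- `v = x ∈ M` is a highest-weight vector, hence lies in `K`: contradiction with `K ∩ K' = 0`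
  have hxK : x ∈ Ksub := by
    change ((x : M) : Word N D → E) ∈ K
    refine Submodule.subset_span ⟨1, (x : Word N D → E), χ, x.2, ?_, by rw [map_one]; rfl⟩
    rw [show ((x : M) : Word N D → E) = v from hxv]
    exact hvχ
  have hx : x ∈ ((Ksub ⊓ K' : Subrepresentation ρM) : Set M) := by
    rw [Subrepresentation.coe_inf]
    exact ⟨hxK, hxK'⟩
  rw [hKK'.inf_eq_bot] at hx
  have hx0 : x = 0 := hx
  apply hv0
  rw [← hxv, hx0]
  rfl

end Basic

end Literature.NumberTheory.DiophantineGeometry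

end
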